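import Summits.ValiantsHypothesis.ValiantsHypothesis.Cruxes.OrbitDimensionBound.Lines.DegreeLadder

set_option linter.dupNamespace false

/-!
# F3 / BC5 witness for the rung `QuadraticShadow` (ladder `Lines/DegreeLadder.lean`, forward rung g7)

The numeric family `DegreeCovering δ` (entries of total degree `≤ δ`) specialises AT THE FLOOR'S PARAMETER `δ = 1`
to the proved floor `SubtorusCovering` — definitionally (`IsDegEquivariantDetRepr 1 = IsEquivariantDetRepr`,
`⌊n/2⌋ + 1 - 1 = ⌊n/2⌋`), so the seed theorem `subtorusCovering_proof` proves the `δ = 1` member by `simpa`, and the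
`δ = 1` shadow follows unconditionally.  The rung is the `δ = 2` member (`QuadraticCovering` / `QuadraticShadow`),
one notch up the SAME dial; it lies outside the Statement's known regime because no lower bound for torus-equivariant
representations of `per_n` with non-affine entries is in print (LR17 treat affine entries only) and the Statement
itself is open.
-/

namespace Summit.ValiantsHypothesis.ValiantsHypothesis.Cruxes.OrbitDimensionBound.Degree

open Summit.ValiantsHypothesis.ValiantsHypothesis.Theorems.FreeSubtorusSubtorusCovering

/-- The family at the floor's parameter IS the floor: closed by the seed theorem. -/
example : DegreeCovering 1 := by
  simpa [DegreeCovering, Admissible, torusGen, isDegEquivariantDetRepr_one_iff,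
    Summit.ValiantsHypothesis.ValiantsHypothesis.Theses.FreeSubtorus.SubtorusCovering] using subtorusCovering_proof

/-- The same, through the recorded `Iff.rfl`. -/
example : DegreeCovering 1 := degreeCovering_one_iff.mpr subtorusCovering_proof

/-- The shadow family at the floor's parameter, unconditionally (seed ⇒ numeric `δ = 1` member ⇒ its shadow). -/
theorem degreeShadow_one_special : DegreeShadow 1 :=
  degreeShadow_of_degreeCovering le_rfl (by simpa [DegreeCovering, Admissible, torusGen, isDegEquivariantDetRepr_one_iff,
    Summit.ValiantsHypothesis.ValiantsHypothesis.Theses.FreeSubtorus.SubtorusCovering] using subtorusCovering_proof)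

/-- And in the floor's own gauge: the `δ = 1` shadow is the floor's shadow `CoveringShadow powLoss`. -/
example : Confusion.CoveringShadow Confusion.powLoss := degreeShadow_one_iff.mp degreeShadow_one_special

end Summit.ValiantsHypothesis.ValiantsHypothesis.Cruxes.OrbitDimensionBound.Degree
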